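import Mathlib
import HarnessLib
import Summits.HubbardSuperconductivity.HubbardSuperconductivity.Theorems.KLProgrammeKLRegimeEngineNearCoefficientNumeral
import Summits.HubbardSuperconductivity.HubbardSuperconductivity.Theorems.KLProgrammeKLRegimeEngineIsoLineAssembly

/-!
# Route `KLProgramme` — ENGINE item stmt-HubbardSuperconductivity-20437, class #6 / (E5-F)ₙ producer, route (M), (R1) NUMERALS (part 2):
# the iso fixed-tuple line with CERTIFIED ABSOLUTE NUMERALS — `fixedTupleL1 ≤ 2⁹·B + 2¹⁷·X` at every resolution, every pattern, under the stub binders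

Cell gate-hubbard-kl, seat hubbard-kl-k3c2-p2 (g12; owner-designate of M1 + M3 of route (M), pen (R59az)).  Part 1 (…EngineNearCoefficientNumeral) certified the near
coefficient `C ≤ 2^25`; this file carries the numeral through the regime shape and the ρ-free assembly (same proofs verbatim, the bound added to the `∃`) and then FIXES
the near radius `ρ := 1/4096` (near `ρ⁹` vs far `ρ⁻¹` at the worst active scale `Λ₁ = 1/128`): `(2^25·(1/4096 + 1/128)³)³ = (35937/2^11)³ ≤ 5404` ⇒ value coefficient
`2·5404/24 ≤ 2⁹`, moment coefficient `2(6·5404 + 3·4096) ≤ 2¹⁷`: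

* `fixedTupleL1_klIsoKernelAt_le_regime_bounded`, `fixedTupleL1_klIsoKernelAt_le_regime_allPatterns_rho_bounded` — bounded twins (`C ≤ 2^25`);
* **`fixedTupleL1_klIsoKernelAt_le_numeral`** (symbol-layer thresholds) and **`fixedTupleL1_klIsoKernelAt_le_numeral_klEng`** (stub binders `c ≤ klEngC₃3`, `U ≤ klEngU₀3`, `klEngL₃`,
  `klEngM₃`, `R.WF2`): for every admissible frame `K`, kernel scale `n`, resolution `m ≥ 1`, label 4-tuple `Ω`, pin `x₁`:
  `fixedTupleL1 β 3 (klIsoKernelAt … K n m) Ω x₁ ≤ 2⁹·B + 2¹⁷·X`, `B` = the `↑↓` value bound on `klBall L μ 0`, `X` = `Λ_m ×` the pinned first moments of the standard tuples at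
  resolution `m` (asked only when `m ≤ n_β`).

In CF units (ROUTE-M-FIT.md): with M2 at every resolution the (E5-F)ₙ fits need `2⁹ + 2¹⁷·c_M/θ ≤ CF`, `2¹⁷·c_M′ ≤ CF` — ample at `klEngGeo8.CF ≥ 2^80`.  Everything is proved; no
definitions; nothing about the model is asserted.  References: BGM 2006 §2.7 (2.69)–(2.71a) [cite: BenfattoGiulianiMastropietro2006].
-/

noncomputable section

namespace Summit.HubbardSuperconductivity.HubbardSuperconductivity.Theorems.EngineV8

set_option linter.dupNamespace false -- summit = problem name (single-conjunct summit), D-0017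

open Set Finset Literature.MathematicalPhysics.QuantumLattice Literature.MathematicalPhysics.QuantumLattice.BandSectorCounting
open Literature.MathematicalPhysics.QuantumLattice.FermiRG Literature.Probability.LatticeModels Literature.Analysis.SpecialFunctions
open Summit.HubbardSuperconductivity.HubbardSuperconductivity.Theorems.DispersionFlow
open Summit.HubbardSuperconductivity.HubbardSuperconductivity.Theorems.KLRegimeSplit
open Summit.HubbardSuperconductivity.HubbardSuperconductivity.Theorems.KLProgrammeLegKernels
open Summit.HubbardSuperconductivity.HubbardSuperconductivity.Theorems.PerturbedFermiCurve
open Summit.HubbardSuperconductivity.HubbardSuperconductivity.Theorems.TorusFourierL2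
open scoped Real

section Regime

open Classical

/-- **The M3 shape in the KL regime WITH THE NUMERAL `C ≤ 2^25`** (statement of `fixedTupleL1_klIsoKernelAt_le_regime` otherwise verbatim). -/
theorem fixedTupleL1_klIsoKernelAt_le_regime_bounded (ha : (-4 : ℝ) < -(6 / 5)) (hab : (-(6 / 5) : ℝ) ≤ -(1 / 10)) (hb : (-(1 / 10) : ℝ) < 0) :
    ∃ C : ℝ, 0 < C ∧ C ≤ 2 ^ 25 ∧ ∀ (R : RenConsts), (∀ j, 0 ≤ R.Gfr j) →
      ∀ (c U : ℝ), 0 < c →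
      c ≤ min (min ((bandBounds ha hab hb).Dtmin / 4) ((bandBounds ha hab hb).rhomin / 4)) (1 / 40) / (12 * (R.Gfr 2 + 1)) → 0 < U →
      U ≤ min 1 (min (min ((bandBounds ha hab hb).Dtmin / 4) ((bandBounds ha hab hb).rhomin / 4)) (1 / 40) / (24 * (R.Gfr 0 + R.Gfr 1 + 1))) →
      ∀ β : ℝ, klBetaMin ≤ β → β ≤ Real.exp (c / U ^ 2) → ∀ μ ∈ klWindowC, ∀ K : TrigPolyC4v, FrameOK R U (nScales β) μ K →
      ∀ (L M : ℕ) [NeZero L] [NeZero M], β ^ 2 ≤ (L : ℝ) → β ≤ (M : ℝ) → ∀ (n m : ℕ), 1 ≤ m → m ≤ nScales β →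
      ∀ (Ω : Fin 4 → SectorLeg (sectorCount (2 * m))), (Ω 0).2 = 0 → (Ω 1).2 = 1 → (Ω 2).2 = 0 → (Ω 3).2 = 1 →
        (Ω 0).1.2 = 0 → (Ω 1).1.2 = 0 → (Ω 2).1.2 = 1 → (Ω 3).1.2 = 1 →
      ∀ (x₁ : SpaceTimeIdx L M) (ρ B Mom : ℝ), 0 < ρ → 0 ≤ B →
        (∀ k₁ ∈ klBall L μ 0, ∀ k₂ ∈ klBall L μ 0, ∀ k₃ ∈ klBall L μ 0, ‖klQuarticValue L M β U μ K n 0 1 k₁ k₂ k₃‖ ≤ B) →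
        (∀ j : Fin 3, imagTimeWeight β M ^ 3 * ∑ y : Fin 3 → SpaceTimeIdx L M,
          spaceTimeDist L M β x₁ (y j) * ‖klIsoKernelAt L M β U μ K n m Ω (Matrix.vecCons x₁ y)‖ ≤ Mom) →
        fixedTupleL1 L M β 3 (klIsoKernelAt L M β U μ K n m) Ω x₁ ≤
          (C * (ρ + klScale klE0 m) ^ 3) ^ 3 * (B / 24 + (klScale klE0 m + π / β) * (3 * Mom)) + 3 * Mom * klScale klE0 m / ρ := by
  obtain ⟨C, hC, hCle, hnear⟩ := near_coefficient_klIso_le_of_thresholds_bounded ha hab hb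
  refine ⟨C, hC, hCle, ?_⟩
  intro R hR c U hc hcle hU hUle β hβmin hβc μ hμ K hK L M _ _ hLβ hβM n m hm1 hmN Ω h0 h1 h2 h3 hs0 hs1 hs2 hs3 x₁ ρ B Mom hρ hB0 hB hMom
  set Bb : BandBounds (-(6 / 5)) (-(1 / 10)) := bandBounds ha hab hb with hBdef
  set κ₀ : ℝ := min (min (Bb.Dtmin / 4) (Bb.rhomin / 4)) (1 / 40) with hκ₀
  have hκ₀pos : 0 < κ₀ := by
    rw [hκ₀]; have := Bb.Dtmin_pos; have := Bb.rhomin_pos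
    exact lt_min (lt_min (by positivity) (by positivity)) (by norm_num)
  have hκ₀40 : κ₀ ≤ 1 / 40 := min_le_right _ _
  have hβ0 : 0 < β := pos_of_klBetaMin_le hβmin
  have he : (0 : ℝ) < klE0 := by norm_num [klE0]
  set Λ : ℝ := klScale klE0 m with hΛdef
  have hΛ0 : 0 < Λ := klth_klScale_pos m
  -- the frame is small on the torus: `|K(p_k)| ≤ κ₀/4`
  have hlog : 1 ≤ Real.log 4 := by
    have h4 : Real.exp 1 ≤ 4 := by have := Real.exp_one_lt_d9; norm_num at this; linarith
    calc (1 : ℝ) = Real.log (Real.exp 1) := (Real.log_exp 1).symm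
      _ ≤ Real.log 4 := Real.log_le_log (Real.exp_pos 1) h4
  have hKev : ∀ k : TorusSite 2 L, |K.eval (latticeMomentum L k)| ≤ κ₀ / 4 := by
    intro k
    refine (abs_eval_latticeMomentum_le_of_frameOK_regime hR hc.le hβmin hβc hK k).trans ?_
    have h0' := hR 0; have h1' := hR 1; have h2' := hR 2
    have hU1 : U ≤ 1 := hUle.trans (min_le_left _ _)
    have hUk : U ≤ κ₀ / (24 * (R.Gfr 0 + R.Gfr 1 + 1)) := hUle.trans (min_le_right _ _)
    rw [abs_of_pos hU]
    have hU2 : U ^ 2 ≤ U := by nlinarith only [hU, hU1]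
    have hA1 : 2 * R.Gfr 0 * U + 2 * R.Gfr 1 * U ^ 2 ≤ 2 * (R.Gfr 0 + R.Gfr 1 + 1) * U := by
      have := mul_le_mul_of_nonneg_left hU2 h1'
      linarith only [this, hU.le]
    have hB1 : 2 * (R.Gfr 0 + R.Gfr 1 + 1) * U ≤ κ₀ / 12 := by
      have hpos : 0 < 24 * (R.Gfr 0 + R.Gfr 1 + 1) := by positivity
      have := (le_div_iff₀ hpos).mp hUk
      linarith only [this]
    have hC1 : R.Gfr 2 * (c / Real.log 4) ≤ R.Gfr 2 * c := mul_le_mul_of_nonneg_left (div_le_self hc.le hlog) h2'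
    have hD1 : R.Gfr 2 * c ≤ κ₀ / 12 := by
      have hpos : 0 < 12 * (R.Gfr 2 + 1) := by positivity
      have := (le_div_iff₀ hpos).mp hcle
      linarith only [this, hc.le]
    linarith only [hA1, hB1, hC1, hD1, hκ₀pos]
  -- `Λ_m + κ₀/4 ≤ klE0` for `m ≥ 1`
  have hΛA : klScale klE0 m + κ₀ / 4 ≤ klE0 := by
    have hΛ1 : klScale klE0 m ≤ klScale klE0 1 := by
      unfold klScale; exact mul_le_mul_of_nonneg_left (inv_anti₀ (by positivity) (pow_le_pow_right₀ (by norm_num) hm1)) he.le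
    have e1 : klScale klE0 1 = klE0 / 4 := by unfold klScale; ring
    have he0 : klE0 = 1 / 32 := rfl
    rw [e1] at hΛ1
    rw [he0] at hΛ1 ⊢
    linarith only [hΛ1, hκ₀40]
  -- the M3 shape with the actual counts
  have hR0 : 0 < ρ / Λ := div_pos hρ hΛ0
  have hshape := fixedTupleL1_klIsoKernelAt_le_of_ballValue_moments_counts hβ0 U μ K hKev n m hΛA Ω h0 h1 h2 h3 hs0 hs1 hs2 hs3 x₁
    (NR := ((((univ : Finset (SpaceTimeIdx L M)).filter fun y => spaceTimeDist L M β x₁ y < ρ / Λ).card : ℕ) : ℝ)) hR0 hB0 hB hMom le_rfl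
  -- the near coefficient
  have hcoef := hnear R hR c U hc hcle hU hUle β hβmin hβc μ hμ K hK L M hLβ hβM m hmN Ω x₁ ρ hρ.le
  rw [← hΛdef] at hcoef
  have hL0 : (0 : ℝ) < L := Nat.cast_pos.2 (NeZero.pos L)
  have hβL : 0 < (β * (L : ℝ) ^ 2) ^ 3 := by positivity
  have hMom0 : 0 ≤ Mom := le_trans (mul_nonneg (pow_nonneg (imagTimeWeight_nonneg hβ0.le M) 3) (sum_nonneg fun y _ =>
    mul_nonneg (by unfold KLRegimeSplit.spaceTimeDist; exact le_max_of_le_right (le_max_of_le_left (Nat.cast_nonneg _))) (norm_nonneg _))) (hMom 0)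
  have hX0 : 0 ≤ B / 24 + (Λ + π / β) * (3 * Mom) := by positivity
  refine hshape.trans ?_
  rw [← hΛdef]
  -- regroup the near term as (coefficient) × (B/24 + …) and the far term as `3·Mom·Λ/ρ`
  have e1 : imagTimeWeight β M ^ 3 *
        ((((univ : Finset (SpaceTimeIdx L M)).filter fun y => spaceTimeDist L M β x₁ y < ρ / Λ).card : ℕ) : ℝ) ^ 3 *
          ((∏ j : Fin 3, ((((univ : Finset (FreqMomentum L M)).filter fun q => klIsoFamily L M β μ K klE0 m (Ω j.succ).1.1 q ≠ 0).card : ℕ) : ℝ)) *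
            ((B / 24 + (Λ + π / β) * (3 * Mom)) / (β * (L : ℝ) ^ 2) ^ 3)) =
      (imagTimeWeight β M ^ 3 *
          ((((univ : Finset (SpaceTimeIdx L M)).filter fun y => spaceTimeDist L M β x₁ y < ρ / Λ).card : ℕ) : ℝ) ^ 3 *
            (∏ j : Fin 3, ((((univ : Finset (FreqMomentum L M)).filter fun q => klIsoFamily L M β μ K klE0 m (Ω j.succ).1.1 q ≠ 0).card : ℕ) : ℝ)) /
          (β * (L : ℝ) ^ 2) ^ 3) * (B / 24 + (Λ + π / β) * (3 * Mom)) := by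
    rw [div_eq_mul_inv, div_eq_mul_inv _ ((β * (L : ℝ) ^ 2) ^ 3)]
    ring
  have e2 : 3 * Mom / (ρ / Λ) = 3 * Mom * Λ / ρ := div_div_eq_mul_div (3 * Mom) ρ Λ
  rw [e1, e2]
  exact add_le_add (mul_le_mul_of_nonneg_right hcoef hX0) le_rfl

/-- **The ρ-free assembly WITH THE NUMERAL `C ≤ 2^25`** (statement of `fixedTupleL1_klIsoKernelAt_le_regime_allPatterns_rho` otherwise verbatim). -/
theorem fixedTupleL1_klIsoKernelAt_le_regime_allPatterns_rho_bounded (ha : (-4 : ℝ) < -(6 / 5)) (hab : (-(6 / 5) : ℝ) ≤ -(1 / 10)) (hb : (-(1 / 10) : ℝ) < 0) :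
    ∃ C : ℝ, 0 < C ∧ C ≤ 2 ^ 25 ∧ ∀ (R : RenConsts), (∀ j, 0 ≤ R.Gfr j) →
      ∀ (c U : ℝ), 0 < c →
      c ≤ min (min ((bandBounds ha hab hb).Dtmin / 4) ((bandBounds ha hab hb).rhomin / 4)) (1 / 40) / (12 * (R.Gfr 2 + 1)) → 0 < U →
      U ≤ min 1 (min (min ((bandBounds ha hab hb).Dtmin / 4) ((bandBounds ha hab hb).rhomin / 4)) (1 / 40) / (24 * (R.Gfr 0 + R.Gfr 1 + 1))) →
      ∀ β : ℝ, klBetaMin ≤ β → β ≤ Real.exp (c / U ^ 2) → ∀ μ ∈ klWindowC, ∀ K : TrigPolyC4v, FrameOK R U (nScales β) μ K →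
      ∀ (L M : ℕ) [NeZero L] [NeZero M], β ^ 2 ≤ (L : ℝ) → β ≤ (M : ℝ) → ∀ (n m : ℕ), 1 ≤ m →
      ∀ (ρ B X : ℝ), 0 < ρ → 0 ≤ B → 0 ≤ X →
        (∀ k₁ ∈ klBall L μ 0, ∀ k₂ ∈ klBall L μ 0, ∀ k₃ ∈ klBall L μ 0, ‖klQuarticValue L M β U μ K n 0 1 k₁ k₂ k₃‖ ≤ B) →
        (m ≤ nScales β → ∀ (ω : Fin 4 → Fin (sectorCount (2 * m))) (x₁ : SpaceTimeIdx L M) (j : Fin 3),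
          klScale klE0 m * (imagTimeWeight β M ^ 3 * ∑ y : Fin 3 → SpaceTimeIdx L M,
            spaceTimeDist L M β x₁ (y j) *
              ‖klIsoKernelAt L M β U μ K n m (fun i => ((ω i, ![(0 : Fin 2), 0, 1, 1] i), ![(0 : Fin 2), 1, 0, 1] i)) (Matrix.vecCons x₁ y)‖) ≤ X) →
      ∀ (Ω : Fin 4 → SectorLeg (sectorCount (2 * m))) (x₁ : SpaceTimeIdx L M),
        fixedTupleL1 L M β 3 (klIsoKernelAt L M β U μ K n m) Ω x₁ ≤ 2 * ((C * (ρ + 1 / 128) ^ 3) ^ 3 * (B / 24 + 6 * X) + 3 * X / ρ) := by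
  obtain ⟨C, hC, hCle, hreg⟩ := fixedTupleL1_klIsoKernelAt_le_regime_bounded ha hab hb
  refine ⟨C, hC, hCle, ?_⟩
  intro R hR c U hc hcle hU hUle β hβmin hβc μ hμ K hK L M _ _ hLβ hβM n m hm1 ρ B X hρ hB0 hX0 hB hMom Ω x₁
  have hβ0 : 0 < β := pos_of_klBetaMin_le hβmin
  have he : (0 : ℝ) < klE0 := by norm_num [klE0]
  have hrhs0 : 0 ≤ (C * (ρ + 1 / 128) ^ 3) ^ 3 * (B / 24 + 6 * X) + 3 * X / ρ := by positivity
  by_cases hmN : m ≤ nScales β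
  swap
  · rw [fixedTupleL1_klIsoKernelAt_eq_zero_of_nScales_lt hβ0 U μ K n (not_le.mp hmN) Ω x₁]; positivity
  set Λ : ℝ := klScale klE0 m with hΛdef
  have hΛ0 : 0 < Λ := klth_klScale_pos m
  have hΛsmall : Λ ≤ 1 / 128 := by
    have h1 : klScale klE0 m ≤ klScale klE0 1 := by
      unfold klScale; exact mul_le_mul_of_nonneg_left (inv_anti₀ (by positivity) (pow_le_pow_right₀ (by norm_num) hm1)) he.le
    have e1 : klScale klE0 1 = 1 / 128 := by unfold klScale klE0; norm_num
    rw [hΛdef]; linarith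
  have hπΛ : π / β ≤ Λ := by
    refine (klth_pi_div_le_klScale_nScales hβmin).trans ?_
    rw [hΛdef]; unfold klScale
    exact mul_le_mul_of_nonneg_left (inv_anti₀ (by positivity) (pow_le_pow_right₀ (by norm_num) hmN)) he.le
  have hstd : ∀ (ω : Fin 4 → Fin (sectorCount (2 * m))) (x : SpaceTimeIdx L M),
      fixedTupleL1 L M β 3 (klIsoKernelAt L M β U μ K n m) (fun i => ((ω i, ![(0 : Fin 2), 0, 1, 1] i), ![(0 : Fin 2), 1, 0, 1] i)) x ≤
        (C * (ρ + 1 / 128) ^ 3) ^ 3 * (B / 24 + 6 * X) + 3 * X / ρ := by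
    intro ω x
    have hMomx : ∀ j : Fin 3, imagTimeWeight β M ^ 3 * ∑ y : Fin 3 → SpaceTimeIdx L M,
        spaceTimeDist L M β x (y j) *
          ‖klIsoKernelAt L M β U μ K n m (fun i => ((ω i, ![(0 : Fin 2), 0, 1, 1] i), ![(0 : Fin 2), 1, 0, 1] i)) (Matrix.vecCons x y)‖ ≤ X / Λ := by
      intro j
      rw [le_div_iff₀ hΛ0, mul_comm]
      exact hMom hmN ω x j
    have h := hreg R hR c U hc hcle hU hUle β hβmin hβc μ hμ K hK L M hLβ hβM n m hm1 hmN
      (fun i => ((ω i, ![(0 : Fin 2), 0, 1, 1] i), ![(0 : Fin 2), 1, 0, 1] i)) rfl rfl rfl rfl rfl rfl rfl rfl x ρ B (X / Λ) hρ hB0 hB hMomx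
    rw [← hΛdef] at h
    refine h.trans ?_
    have hcoef : (C * (ρ + Λ) ^ 3) ^ 3 ≤ (C * (ρ + 1 / 128) ^ 3) ^ 3 := by
      have h1 : (ρ + Λ) ^ 3 ≤ (ρ + 1 / 128) ^ 3 := pow_le_pow_left₀ (by linarith) (by linarith) 3
      exact pow_le_pow_left₀ (by positivity) (mul_le_mul_of_nonneg_left h1 hC.le) 3
    have e3 : 3 * (X / Λ) * Λ / ρ = 3 * X / ρ := by field_simp
    have hmid : (Λ + π / β) * (3 * (X / Λ)) ≤ 6 * X := by
      have : (Λ + π / β) * (3 * (X / Λ)) ≤ (2 * Λ) * (3 * (X / Λ)) :=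
        mul_le_mul_of_nonneg_right (by linarith) (by positivity)
      refine this.trans (le_of_eq ?_)
      field_simp; ring
    rw [e3]
    have := mul_le_mul hcoef (by linarith : B / 24 + (Λ + π / β) * (3 * (X / Λ)) ≤ B / 24 + 6 * X) (by positivity) (by positivity)
    linarith
  have h2 := fixedTupleL1_klIsoKernelAt_le_two_mul_of_std hβ0 U μ K n m (S := (C * (ρ + 1 / 128) ^ 3) ^ 3 * (B / 24 + 6 * X) + 3 * X / ρ) hrhs0 hstd Ω x₁
  linarith

/-- **THE ISO LINE WITH ABSOLUTE NUMERALS** (symbol-layer thresholds; all patterns; `m ≥ 1`; near radius fixed at `ρ = 1/4096`):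
`fixedTupleL1 β 3 (klIsoKernelAt … K n m) Ω x₁ ≤ 2⁹·B + 2¹⁷·X`. -/
theorem fixedTupleL1_klIsoKernelAt_le_numeral (ha : (-4 : ℝ) < -(6 / 5)) (hab : (-(6 / 5) : ℝ) ≤ -(1 / 10)) (hb : (-(1 / 10) : ℝ) < 0)
    (R : RenConsts) (hR : ∀ j, 0 ≤ R.Gfr j) (c U : ℝ) (hc : 0 < c)
    (hcle : c ≤ min (min ((bandBounds ha hab hb).Dtmin / 4) ((bandBounds ha hab hb).rhomin / 4)) (1 / 40) / (12 * (R.Gfr 2 + 1))) (hU : 0 < U)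
    (hUle : U ≤ min 1 (min (min ((bandBounds ha hab hb).Dtmin / 4) ((bandBounds ha hab hb).rhomin / 4)) (1 / 40) / (24 * (R.Gfr 0 + R.Gfr 1 + 1))))
    (β : ℝ) (hβmin : klBetaMin ≤ β) (hβc : β ≤ Real.exp (c / U ^ 2)) (μ : ℝ) (hμ : μ ∈ klWindowC) (K : TrigPolyC4v) (hK : FrameOK R U (nScales β) μ K)
    (L M : ℕ) [NeZero L] [NeZero M] (hLβ : β ^ 2 ≤ (L : ℝ)) (hβM : β ≤ (M : ℝ)) (n m : ℕ) (hm1 : 1 ≤ m) (B X : ℝ) (hB0 : 0 ≤ B) (hX0 : 0 ≤ X)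
    (hB : ∀ k₁ ∈ klBall L μ 0, ∀ k₂ ∈ klBall L μ 0, ∀ k₃ ∈ klBall L μ 0, ‖klQuarticValue L M β U μ K n 0 1 k₁ k₂ k₃‖ ≤ B)
    (hMom : m ≤ nScales β → ∀ (ω : Fin 4 → Fin (sectorCount (2 * m))) (x₁ : SpaceTimeIdx L M) (j : Fin 3),
      klScale klE0 m * (imagTimeWeight β M ^ 3 * ∑ y : Fin 3 → SpaceTimeIdx L M,
        spaceTimeDist L M β x₁ (y j) *
          ‖klIsoKernelAt L M β U μ K n m (fun i => ((ω i, ![(0 : Fin 2), 0, 1, 1] i), ![(0 : Fin 2), 1, 0, 1] i)) (Matrix.vecCons x₁ y)‖) ≤ X)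
    (Ω : Fin 4 → SectorLeg (sectorCount (2 * m))) (x₁ : SpaceTimeIdx L M) :
    fixedTupleL1 L M β 3 (klIsoKernelAt L M β U μ K n m) Ω x₁ ≤ 2 ^ 9 * B + 2 ^ 17 * X := by
  obtain ⟨C, hC, hCle, h⟩ := fixedTupleL1_klIsoKernelAt_le_regime_allPatterns_rho_bounded ha hab hb
  have hρ : (0 : ℝ) < 1 / 4096 := by norm_num
  have hb' := h R hR c U hc hcle hU hUle β hβmin hβc μ hμ K hK L M hLβ hβM n m hm1 (1 / 4096) B X hρ hB0 hX0 hB hMom Ω x₁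
  refine hb'.trans ?_
  -- `(C·(1/4096 + 1/128)³)³ ≤ (2^25·(33/4096)³)³ ≤ 5404`
  have hcube : (C * (1 / 4096 + 1 / 128) ^ 3) ^ 3 ≤ 5404 := by
    have h1 : C * (1 / 4096 + 1 / 128) ^ 3 ≤ 2 ^ 25 * (1 / 4096 + 1 / 128) ^ 3 := mul_le_mul_of_nonneg_right hCle (by positivity)
    have h2 : (C * (1 / 4096 + 1 / 128) ^ 3) ^ 3 ≤ (2 ^ 25 * (1 / 4096 + 1 / 128) ^ 3) ^ 3 := pow_le_pow_left₀ (by positivity) h1 3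
    exact h2.trans (by norm_num)
  have hcube0 : 0 ≤ (C * (1 / 4096 + 1 / 128) ^ 3) ^ 3 := by positivity
  nlinarith [mul_le_mul_of_nonneg_right hcube (by positivity : (0 : ℝ) ≤ B / 24 + 6 * X)]

end Regime

/-! ## Under the engine's stub binders -/

section Tokens

/-- **THE ISO LINE WITH ABSOLUTE NUMERALS UNDER THE STUB BINDERS** (`R.WF2`, `c ≤ klEngC₃3 P R`, `U ≤ klEngU₀3 P R c`, `klEngL₃ β U ≤ L`, `klEngM₃ β U L ≤ M`; any admissible `K`,
any kernel scale `n`, resolution `m ≥ 1`, every label 4-tuple and pin): `fixedTupleL1 β 3 (klIsoKernelAt … K n m) Ω x₁ ≤ 2⁹·B + 2¹⁷·X`. -/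
theorem fixedTupleL1_klIsoKernelAt_le_numeral_klEng (P : SplitConsts) (R : RenConsts) (c : ℝ) (hR2 : R.WF2) (hc : 0 < c) (hc3 : c ≤ klEngC₃3 P R)
    {μ : ℝ} (hμ : μ ∈ klWindowC) {U : ℝ} (hU : 0 < U) (hU3 : U ≤ klEngU₀3 P R c) {β : ℝ} (hβmin : klBetaMin ≤ β) (hβc : β ≤ Real.exp (c / U ^ 2))
    {K : TrigPolyC4v} (hK : FrameOK R U (nScales β) μ K) {L M : ℕ} [NeZero L] [NeZero M] (hL3 : klEngL₃ β U ≤ L) (hM3 : klEngM₃ β U L ≤ M)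
    (n : ℕ) {m : ℕ} (hm1 : 1 ≤ m) {B X : ℝ} (hB0 : 0 ≤ B) (hX0 : 0 ≤ X)
    (hB : ∀ k₁ ∈ klBall L μ 0, ∀ k₂ ∈ klBall L μ 0, ∀ k₃ ∈ klBall L μ 0, ‖klQuarticValue L M β U μ K n 0 1 k₁ k₂ k₃‖ ≤ B)
    (hMom : m ≤ nScales β → ∀ (ω : Fin 4 → Fin (sectorCount (2 * m))) (x₁ : SpaceTimeIdx L M) (j : Fin 3),
      klScale klE0 m * (imagTimeWeight β M ^ 3 * ∑ y : Fin 3 → SpaceTimeIdx L M,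
        spaceTimeDist L M β x₁ (y j) *
          ‖klIsoKernelAt L M β U μ K n m (fun i => ((ω i, ![(0 : Fin 2), 0, 1, 1] i), ![(0 : Fin 2), 1, 0, 1] i)) (Matrix.vecCons x₁ y)‖) ≤ X)
    (Ω : Fin 4 → SectorLeg (sectorCount (2 * m))) (x₁ : SpaceTimeIdx L M) :
    fixedTupleL1 L M β 3 (klIsoKernelAt L M β U μ K n m) Ω x₁ ≤ 2 ^ 9 * B + 2 ^ 17 * X := by
  have ha : (-4 : ℝ) < -(6 / 5) := by norm_num
  have hab : (-(6 / 5) : ℝ) ≤ -(1 / 10) := by norm_num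
  have hb : (-(1 / 10) : ℝ) < 0 := by norm_num
  have hRj : ∀ j, 0 ≤ R.Gfr j := gfr_nonneg_of_wf2 hR2
  exact fixedTupleL1_klIsoKernelAt_le_numeral ha hab hb R hRj c U hc (hc3.trans (klEngC₃3_le_symbolC₃ ha hab hb P hRj)) hU
    (hU3.trans (klEngU₀3_le_symbolU₀ ha hab hb P hRj c)) β hβmin hβc μ hμ K hK L M (sq_le_of_klEngL₃_le hL3) (le_of_klEngM₃_le hβmin hL3 hM3)
    n m hm1 B X hB0 hX0 hB hMom Ω x₁

end Tokens

end Summit.HubbardSuperconductivity.HubbardSuperconductivity.Theorems.EngineV8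

end
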